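import Mathlib

/-!
# The D₄ triple-surface configuration: a finite certificate (p5, pub-hodge-repro0)

Abstract CM configuration of P5-Dim6Census §4 on the points 0..11: three blocks {0,1,2,3}, {4,5,6,7}, {8,9,10,11};
`iotaL` = x ↦ x+2 inside each block; the group `Tgrp = ⟨rL, sL⟩ ≅ D₄` (eight permutations listed explicitly as lists of images);
the CM type `PhiL = {0,1,4,7,8,9}`; the set `DeltaL = {0,4,10,11}`.  Certified by `decide`: (1) the listed Tgrp is closed under
composition, has 8 elements, contains iotaL = rL², and iotaL is central; PhiL contains exactly one point of each iotaL-pair; (2) DeltaL is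
balancedB of weight 2 (every t ∈ Tgrp has |tΔ ∩ PhiL| = 2); (3) DeltaL contains no balancedB pair (so it is primitive); (4) the
orbit of DeltaL under Tgrp has exactly 4 elements and the stabiliser has 2.  Balanced sets are the Hodge sets by Pohlmann's
criterion (P5-RED-WEIL Lemma 3.3, a paper statement): this file certifies only the finite combinatorics (ROUTE R-5).
-/

namespace HodgeRepro0.P5D4TripleSurfaces

/-- a permutation of {0,…,11} as the list of images -/
abbrev PermL := List Nat

/-- applyL a permutation (list of images) to a point -/
def applyL (p : PermL) (i : Nat) : Nat := p.getD i i

/-- composition p ∘ q of permutations of {0,…,11} -/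
def compL (p q : PermL) : PermL := (List.range 12).map (fun i => applyL p (applyL q i))

/-- the involution iotaL (complex conjugation): x ↦ x + 2 inside each block -/
def iotaL : PermL := [2, 3, 0, 1, 6, 7, 4, 5, 10, 11, 8, 9]
/-- rL = (0 1 2 3)(4 5 6 7)(8 11 10 9) -/
def rL : PermL := [1, 2, 3, 0, 5, 6, 7, 4, 11, 8, 9, 10]
/-- sL = (1 3)(5 7)(8 9)(10 11) -/
def sL : PermL := [0, 3, 2, 1, 4, 7, 6, 5, 9, 8, 11, 10]
/-- the identity permutation -/
def idL : PermL := List.range 12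

/-- the eight elements of Tgrp = ⟨rL, sL⟩ -/
def Tgrp : List PermL := [idL, rL, compL rL rL, compL rL (compL rL rL), sL, compL rL sL, compL (compL rL rL) sL, compL (compL rL (compL rL rL)) sL]

/-- the CM type PhiL -/
def PhiL : List Nat := [0, 1, 4, 7, 8, 9]
/-- the balancedB 4-set DeltaL -/
def DeltaL : List Nat := [0, 4, 10, 11]

/-- the image t(S) of a set of points -/
def actL (t : PermL) (S : List Nat) : List Nat := S.map (applyL t)

/-- number of points of S (a list without repetition) lying in PhiL -/
def meetPhi (S : List Nat) : Nat := (S.filter (fun x => decide (x ∈ PhiL))).length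

/-- balancedB of weight p: every translate meets PhiL in exactly p points -/
def balancedB (p : Nat) (S : List Nat) : Bool := Tgrp.all (fun t => meetPhi (actL t S) == p)

/-- Tgrp has eight elements -/
theorem Tgrp_length : Tgrp.length = 8 := by decide
/-- iotaL = rL² -/
theorem iota_eq_rsq : compL rL rL = iotaL := by decide
/-- Tgrp is closed under composition (so it is the group ⟨rL, sL⟩) -/
theorem Tgrp_closed : Tgrp.all (fun a => Tgrp.all (fun b => decide (compL a b ∈ Tgrp))) = true := by decide
/-- iotaL commutes with every element of Tgrp -/
theorem iota_central_in_Tgrp : Tgrp.all (fun a => decide (compL a iotaL = compL iotaL a)) = true := by decide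
/-- PhiL contains exactly one point of each iotaL-pair (a CM type) -/
theorem Phi_is_cm_type : (List.range 12).all (fun x => decide ((x ∈ PhiL) ↔ ¬ (applyL iotaL x ∈ PhiL))) = true := by decide

/-- DeltaL is balancedB of weight 2: |tΔ ∩ PhiL| = 2 for every t ∈ Tgrp -/
theorem Delta_is_balanced : balancedB 2 DeltaL = true := by decide

/-- no 2-subset of DeltaL is balancedB of weight 1: DeltaL is primitive -/
theorem Delta_is_primitive :
    ([[0,4],[0,10],[0,11],[4,10],[4,11],[10,11]] : List (List Nat)).all (fun P => !(balancedB 1 P)) = true := by decide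

/-- set equality of lists of naturals -/
def sameSetB (A B : List Nat) : Bool := A.all (fun x => decide (x ∈ B)) && B.all (fun x => decide (x ∈ A))

/-- the four sets claimed to form the orbit of DeltaL -/
def orbitSetsL : List (List Nat) := [[0, 4, 10, 11], [1, 5, 9, 10], [2, 6, 8, 9], [3, 7, 8, 11]]

/-- every translate of DeltaL is one of the four listed sets, every listed set is a translate, and the four are distinct:
the orbit of DeltaL has exactly 4 elements -/
theorem Delta_orbit_four :
    (Tgrp.all (fun t => orbitSetsL.any (fun S => sameSetB (actL t DeltaL) S)) &&
     orbitSetsL.all (fun S => Tgrp.any (fun t => sameSetB (actL t DeltaL) S)) &&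
     decide (orbitSetsL.Pairwise (fun A B => sameSetB A B = false))) = true := by decide

/-- the stabiliser of DeltaL in Tgrp has 2 elements (so |O| = 8/2 = 4) -/
theorem Delta_stab_two : (Tgrp.filter (fun t => sameSetB (actL t DeltaL) DeltaL)).length = 2 := by decide

end HodgeRepro0.P5D4TripleSurfaces
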